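import Literature.Computability.QuantumComplexity.SandwichBlock
import Literature.Computability.QuantumComplexity.PhaseKickProgram
import HarnessLib

/-!
# The Hadamard-sandwich block encoding, III: diagonal targets (no column mixing)

Topic `Literature/Computability/QuantumComplexity`; sequel of `SandwichBlock.lean`. For a *diagonal*
target (a controlled phase such as the AJL factor `e^{±3πi/5}`) the sandwich needs no `CNOT`: with
`W' = L_rev · diag(i^g) · L` over the Hadamard wires `ws`,

* `hadSandwich_diag_apply`: between labels clean on `ws`,
  `W' x z = [z ≡ x off ws] · (1/2)^{|ws|} · Σ_{y ∈ fibre z} i^{g y}`;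
* `sandwich_diag_entry`: re-indexed, `= [⋯] · (1/2)^{|ws|} Σ_{n < 2^{|ws|}} i^{g (writeNat ws z n)}`;
* `sum_range_two_pow_succ_writeNat`: with `ws = as ++ [r]` the sum splits by the bit on the
  selector wire `r`: `Σ_{n < 2^{k+1}} F(writeNat (as ++ [r]) z n) = Σ_{n<2^k} F(writeNat as z[r↦0] n) + Σ_{n<2^k} F(writeNat as z[r↦1] n)`;
* `sum_I_pow_one_add_two_mul_toNat`: `Σ_{n<2^k} i^{1 + 2[σ n]} = i·(2^k − 2#σ)`;
* the circuit `phaseSandwichCircuit ws ops h Fs Fz` (`H`-layer, `phaseKickCircuit`, reversed `H`-layer)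
  with `phaseSandwichCircuit_toMatrix`.

## References

* D. W. Berry, A. M. Childs, R. Cleve, R. Kothari, R. D. Somma, STOC 2014, §3 [BerryEtAl2014].
-/

noncomputable section

namespace Literature.Computability.QuantumComplexity

open _root_.Matrix Finset Cryptography

variable {N : ℕ}

/-- **Entries of the diagonal sandwich** between labels clean on `ws`. [cite: BerryEtAl2014, §3] -/
theorem hadSandwich_diag_apply {ws : List (Fin N)} (hws : ws.Nodup) (g : QReg N → ℕ) {x z : QReg N}
    (hx : ∀ i ∈ ws, x i = false) (hz : ∀ i ∈ ws, z i = false) :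
    (hadLayerRev ws * phaseDiag g * hadLayer ws) x z =
      if EqOff ws z x then ((1 / 2 : ℝ) : ℂ) ^ ws.length * ∑ y ∈ fibreOff ws z, Complex.I ^ g y else 0 := by
  rw [hadSandwich_apply hws _ hx hz]
  have inner : ∀ y', (∑ y ∈ fibreOff ws z, phaseDiag g y' y) = if y' ∈ fibreOff ws z then Complex.I ^ g y' else 0 := by
    intro y'
    simp only [phaseDiag, Matrix.diagonal_apply]
    rw [Finset.sum_ite_eq]
  simp_rw [inner]
  rw [← Finset.sum_filter]
  by_cases h : EqOff ws z x
  · rw [if_pos h]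
    congr 1
    apply Finset.sum_congr _ fun _ _ => rfl
    ext y
    simp only [Finset.mem_filter, mem_fibreOff]
    exact ⟨fun hh => hh.2, fun hh => ⟨hh.trans h, hh⟩⟩
  · rw [if_neg h]
    convert mul_zero _
    apply Finset.sum_eq_zero
    intro y hy
    simp only [Finset.mem_filter, mem_fibreOff] at hy
    exact absurd (hy.2.symm.trans hy.1) h

/-- **Entries of the diagonal sandwich, re-indexed by the number on `ws`.** [cite: BerryEtAl2014, §3] -/
theorem sandwich_diag_entry {ws : List (Fin N)} (hws : ws.Nodup) (g : QReg N → ℕ) {x z : QReg N}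
    (hx : ∀ i ∈ ws, x i = false) (hz : ∀ i ∈ ws, z i = false) :
    (hadLayerRev ws * phaseDiag g * hadLayer ws) x z =
      if EqOff ws z x then ((1 / 2 : ℝ) : ℂ) ^ ws.length * ∑ n ∈ Finset.range (2 ^ ws.length), Complex.I ^ g (writeNat ws z n)
      else 0 := by
  rw [hadSandwich_diag_apply hws g hx hz, sum_fibreOff_eq_sum_range ws hws]

/-- **Entries of the diagonal sandwich over `r :: as`, split by the selector bit on `r`.**
[cite: BerryEtAl2014, §3] -/
theorem sandwich_diag_entry_cons {r : Fin N} {as : List (Fin N)} (hnd : (r :: as).Nodup) (g : QReg N → ℕ) {x z : QReg N}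
    (hx : ∀ i ∈ r :: as, x i = false) (hz : ∀ i ∈ r :: as, z i = false) :
    (hadLayerRev (r :: as) * phaseDiag g * hadLayer (r :: as)) x z =
      if EqOff (r :: as) z x then
        ((1 / 2 : ℝ) : ℂ) ^ (as.length + 1) *
          ((∑ n ∈ Finset.range (2 ^ as.length), Complex.I ^ g (writeNat as (Function.update z r false) n)) +
            ∑ n ∈ Finset.range (2 ^ as.length), Complex.I ^ g (writeNat as (Function.update z r true) n))
      else 0 := by
  have hr : r ∉ as := (List.nodup_cons.1 hnd).1
  have has : as.Nodup := (List.nodup_cons.1 hnd).2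
  rw [hadSandwich_diag_apply hnd g hx hz, List.length_cons]
  split_ifs with h
  · congr 1
    rw [← Finset.sum_filter_add_sum_filter_not (fibreOff (r :: as) z) (fun y => y r = false)]
    have e1 : (fibreOff (r :: as) z).filter (fun y => ¬ y r = false) = (fibreOff (r :: as) z).filter (fun y => y r = true) :=
      Finset.filter_congr fun y _ => by cases y r <;> simp
    rw [e1, filter_fibreOff_cons hr z false, filter_fibreOff_cons hr z true, sum_fibreOff_eq_sum_range as has,
      sum_fibreOff_eq_sum_range as has]
  · rfl

/-- **Sign sums with a factor `i`**: `Σ_{n < 2^k} i^{1 + 2[σ n]} = i · (2^k − 2·#{n < 2^k | σ n})`. [folklore] -/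
theorem sum_I_pow_one_add_two_mul_toNat (k : ℕ) (σ : ℕ → Bool) :
    ∑ n ∈ Finset.range (2 ^ k), Complex.I ^ (1 + 2 * (σ n).toNat) =
      Complex.I * ((2 ^ k : ℂ) - 2 * (((Finset.range (2 ^ k)).filter fun n => σ n = true).card : ℂ)) := by
  rw [← sum_I_pow_two_mul_toNat, Finset.mul_sum]
  exact Finset.sum_congr rfl fun n _ => by rw [pow_add, pow_one]

/-- **Entries of the diagonal sandwich for a selector-split sign predicate**: if the exponent is
`2[σ₀ n]` on the `r = 0` half and `1 + 2[σ₁ n]` on the `r = 1` half, then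
`2·W' x z = [z ≡ x off r :: as] · ((1 − 2#σ₀/2^k) + i (1 − 2#σ₁/2^k))`. [cite: BerryEtAl2014, §3] -/
theorem two_mul_sandwich_diag_entry_of_sign {r : Fin N} {as : List (Fin N)} (hnd : (r :: as).Nodup) (g : QReg N → ℕ)
    {x z : QReg N} (hx : ∀ i ∈ r :: as, x i = false) (hz : ∀ i ∈ r :: as, z i = false) (σ₀ σ₁ : ℕ → Bool)
    (hg₀ : ∀ n, n < 2 ^ as.length → g (writeNat as (Function.update z r false) n) = 2 * (σ₀ n).toNat)
    (hg₁ : ∀ n, n < 2 ^ as.length → g (writeNat as (Function.update z r true) n) = 1 + 2 * (σ₁ n).toNat) :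
    2 * (hadLayerRev (r :: as) * phaseDiag g * hadLayer (r :: as)) x z =
      if EqOff (r :: as) z x then
        ((1 : ℂ) - 2 * (((Finset.range (2 ^ as.length)).filter fun n => σ₀ n = true).card : ℂ) / 2 ^ as.length) +
          Complex.I * ((1 : ℂ) - 2 * (((Finset.range (2 ^ as.length)).filter fun n => σ₁ n = true).card : ℂ) / 2 ^ as.length)
      else 0 := by
  rw [sandwich_diag_entry_cons hnd g hx hz]
  split_ifs with h
  · have s0 : (∑ n ∈ Finset.range (2 ^ as.length), Complex.I ^ g (writeNat as (Function.update z r false) n)) =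
        ∑ n ∈ Finset.range (2 ^ as.length), Complex.I ^ (2 * (σ₀ n).toNat) :=
      Finset.sum_congr rfl fun n hn => by rw [hg₀ n (Finset.mem_range.1 hn)]
    have s1 : (∑ n ∈ Finset.range (2 ^ as.length), Complex.I ^ g (writeNat as (Function.update z r true) n)) =
        ∑ n ∈ Finset.range (2 ^ as.length), Complex.I ^ (1 + 2 * (σ₁ n).toNat) :=
      Finset.sum_congr rfl fun n hn => by rw [hg₁ n (Finset.mem_range.1 hn)]
    rw [s0, s1, sum_I_pow_two_mul_toNat, sum_I_pow_one_add_two_mul_toNat]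
    have h2 : (2 : ℂ) ^ as.length ≠ 0 := pow_ne_zero _ two_ne_zero
    have hhalf : ((1 / 2 : ℝ) : ℂ) ^ (as.length + 1) = ((2 : ℂ) ^ as.length)⁻¹ / 2 := by
      push_cast; rw [pow_succ, one_div, inv_pow]; ring
    rw [hhalf]
    field_simp
  · simp

/-! ### The diagonal sandwich circuit -/

section Circuit

variable (ws : List (Fin N)) (ops : List (ClOp (Fin N))) (h : ∀ op ∈ ops, op.WF) (Fs Fz : List (Fin N))

/-- **The diagonal sandwich circuit** (no column mixing). [cite: BerryEtAl2014, §3] -/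
def phaseSandwichCircuit : QCircuit cliffordT N :=
  (((⟨ws.map hOn⟩ : QCircuit cliffordT N).append (phaseKickCircuit ops h Fs Fz)).append ⟨(ws.map hOn).reverse⟩)

/-- Its matrix. [cite: BerryEtAl2014, §3] -/
theorem phaseSandwichCircuit_toMatrix :
    (phaseSandwichCircuit ws ops h Fs Fz).toMatrix 0 = hadLayerRev ws * phaseDiag (phaseKickExp ops Fs Fz) * hadLayer ws := by
  rw [phaseSandwichCircuit, QCircuit.toMatrix_append, QCircuit.toMatrix_append, phaseKickCircuit_toMatrix, hadLayerRev, hadLayer,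
    Matrix.mul_assoc]

/-- It is oracle-free. [folklore] -/
theorem phaseSandwichCircuit_isOracleFree : (phaseSandwichCircuit ws ops h Fs Fz).IsOracleFree := by
  intro g hg
  simp only [phaseSandwichCircuit, QCircuit.append, List.mem_append, List.mem_map, List.mem_reverse] at hg
  rcases hg with (⟨i, _, rfl⟩ | hg) | ⟨i, _, rfl⟩
  · trivial
  · exact phaseKickCircuit_isOracleFree ops h Fs Fz g hg
  · trivial

end Circuit

end Literature.Computability.QuantumComplexity

end
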